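import Summits.Langlands.Langlands.Theses.OrdinaryPrimeTransport
import Summits.Langlands.Langlands.Theorems.IrreducibilityBySelfDualityIrreducibleOffSectorOfReciprocity
import HarnessLib

/-!
# Crux stmt-Langlands-17214 `OrdinaryPrimeTransport.IrreducibleOffPrimeRankSector` — the typed DECOMPOSITION
`ReciprocityUpToIrreducibilityR → PairLBoundaryJS → PairLPoleJS → IrreducibleOffPrimeRankSector`, glue PROVED
(crux-strategist `cstrat-stmt-Langlands-17214-b1`, 2026-08-17; crux workfile `Lines/split_reciprocity_js.lean`)

The crux (rank 9; "the rest of the irreducibility clause": for every `n ≥ 1`, number field `K`, L-algebraic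
cuspidal `π` of `GL_n(𝔸_K)` OFF the prime-rank sector, every a.e. Satake–Frobenius-compatible
`ρ : Γ_K → GL_n(ℚ̄_ℓ)` is irreducible) is a COROLLARY NODE of three statements that already live in the
ledger as shared items of other routes, none of which is the crux reworded:

* `ReciprocityUpToIrreducibilityR` — VERBATIM item stmt-Langlands-17925 (route IrreducibilityBySelfDuality,
  rank 7): the revised summit (`∀ F, Nonempty (ReciprocityData F) ∧ ∀ 𝓡 …`, operator p141787) minus
  irreducibility/uniqueness — reciprocity data exist, and for EVERY datum `Rec`: (A') every L-algebraic cuspidal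
  `π` has SOME geometric corresponding `ρ`, and (B) `GaloisToAutomorphic`.  OPEN (it is the rest of the
  mountain); this route's own `closes` must bind it anyway once re-glued for the revised summit (its current
  binder `ReciprocityUpToIrreducibility` = stmt-Langlands-14328 is the `∃ Rec` form, which no longer reaches
  `Langlands`).
* `PairLBoundaryJS` — VERBATIM item stmt-Langlands-13622 (shared by six routes): Arthur–Clozel Ch. 3 (2.2) for
  Borel–Jacquet data = the Literature named fact `JacquetShalika1981_partialPairL_boundary_repData`,
  definitionally (`pairLBoundaryJS_iff` below is `Iff.rfl`).  A THEOREM in print (formalization debt).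
* `PairLPoleJS` — VERBATIM item stmt-Langlands-19093 (shared by six routes): Arthur–Clozel (2.3) = the named
  fact `JacquetShalika1981_partialPairL_pole_repData`, definitionally (`pairLPoleJS_iff`).  A THEOREM in print.

**Glue** (`IrreducibleOffPrimeRankSector_of_subs`, kernel-checked, no `sorry`, axioms propext / Classical.choice /
Quot.sound): fix the field `K` of the crux's binder, take ONE reciprocity datum from the non-vacuity conjunct of
E_R, and run the LANDED isobaric bootstrap `IrreducibleOffSector.isIrreducible_of_reciprocityUpToIrreducibility`
(p103935; Calegari–Gee 2013 §1.1 / Ramakrishnan 2008 §0: the geometric avatar of (A') has geometric irreducible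
constituents, (B) makes each cuspidal automorphic, Jacquet–Shalika isobaric rigidity forbids ≥ 2 of them, and
irreducibility passes to every a.e.-compatible `ρ` by Chebotarev–Brauer–Nesbitt).  The sector hypothesis of the
crux is NOT used: the same three hypotheses give irreducibility of EVERY a.e.-compatible avatar of EVERY
L-algebraic cuspidal `π` (`irreducible_all_of_subs`), in particular also the route's target
`IrreduciblePrimeRank` (`IrreduciblePrimeRank_of_subs`) — recorded so that nobody mistakes the decomposition
for progress on the sector: the route's OWN content is the E-free proof of `IrreduciblePrimeRank` from its four
cruxes; this component only certifies that the off-sector complement costs nothing beyond E_R and two printed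
analytic theorems, i.e. that NO lead prover should be seated on stmt-Langlands-17214 (cf. the thirteen lead
cycles on the sibling crux stmt-Langlands-14329, `Cruxes/IrreducibleOffSector/Lines/Sketch-dead.md`).

Also recorded, on this route's CURRENT item (the `∃ Rec` form E = stmt-Langlands-14328, by name):
`IrreducibleOffPrimeRankSector_of_reciprocity : PairLBoundaryJS → PairLPoleJS → ReciprocityUpToIrreducibility →
IrreducibleOffPrimeRankSector`.

PUBLICATION SHAPE (same as `Cruxes/SectorComplement/Lines/SectorComplementOfLeaves_AnalyticDescent.lean`): §0 declares
the three children as LOCAL propositions with EXACTLY the texts of `children.json` (= the ledger signatures of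
17925 / 13622 / 19093, byte-for-byte), in a `Cruxes.…` namespace so that this module keeps elaborating after
`ledger route edit route-Langlands-OrdinaryPrimeTransport --split IrreducibleOffPrimeRankSector --into children.json`
adds decls with the same names and bodies to the route file; the by-name glue over the route decls is then
`IrreducibleOffPrimeRankSector_of_subs` up to δ, to be landed by a prover under
`Theorems/OrdinaryPrimeTransportIrreducibleOffPrimeRankSectorSplit.lean` (planners cannot write under `Theorems/`).

STATE OF THE TREE (2026-08-17, for the operator / the route's repair planner): the revised summit statement
(p141787: `Langlands := ∀ F, Nonempty (ReciprocityData F) ∧ ∀ 𝓡 n, …`) has silently broken (i) this route's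
deciding theorem `Theses/OrdinaryPrimeTransport.lean: closes` (rev 13: `refine ⟨Rec, …⟩` against the old `∃ 𝓡`
shape — `lean check` rc 1, audit `glue.sorry`; the ledger still shows READY) and (ii)
`Theorems/IrreducibilityBySelfDualityIrreducibleOffSectorTransfer.lean:230–232` (`isIrreducible_of_langlands`:
`obtain ⟨𝓡, h𝓡⟩ := hLang K` now yields `𝓡 : Nonempty …`; one-line fix `obtain ⟨⟨𝓡⟩, h𝓡⟩ := hLang K` +
`(h𝓡 𝓡 n hn hcpt).1`), a module imported — directly or through `…OfReciprocity` / `…OfWeak` — by ≈ 39 files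
including this one and the crux's birth skeleton; all of them currently elaborate only against stale farm
oleans.  Nothing in THIS file depends on the shape of `Langlands`.

References: F. Calegari, T. Gee, Ann. Inst. Fourier 63 (2013) §1.1 [CalegariGee2013]; D. Ramakrishnan,
*Irreducibility and cuspidality*, Progr. Math. 270 (2008) §0 [arXiv:math/0609460]; K. Buzzard, T. Gee, LMS LNS
414 (2014) Conj. 3.2.1–3.2.2 [BuzzardGeeLMS2014]; J.-M. Fontaine, B. Mazur (1995) Conj. 1
[FontaineMazurGeometric1995]; J. Arthur, L. Clozel, Ann. Math. Stud. 120, Ch. 3 §2 (2.2)–(2.3) [ArthurClozelAMS120];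
H. Jacquet, J. Shalika, AJM 103 (1981) [JacquetShalikaAJM1981, JacquetShalikaAJM1981II]; P. Deligne, J.-P. Serre,
ASENS 7 (1974) Lemme 3.2 [DeligneSerreASENS1974].
-/

noncomputable section

set_option linter.dupNamespace false -- project-wide option; `Summit.Langlands.Langlands` is the mandated namespace

open scoped BigOperators NumberField Classical Polynomial Topology
open Filter IsDedekindDomain
open Literature.NumberTheory.Automorphic Literature.NumberTheory.GaloisRepresentations
open Summit.Langlands
open Summit.Langlands.Langlands.Theorems.IrreducibleOffSector (isIrreducible_of_reciprocityUpToIrreducibility)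

/-! ## §0 The three children, as local propositions (texts = children.json = the ledger signatures, VERBATIM) -/

namespace Summit.Langlands.Langlands.Cruxes.IrreducibleOffPrimeRankSector.SplitReciprocityJS

/-- Child E_R (children.json `ReciprocityUpToIrreducibilityR`; = item stmt-Langlands-17925 verbatim): reciprocity
data exist, and for EVERY datum reciprocity holds up to irreducibility/uniqueness, both directions, all `n`,
all `F`. OPEN. [cite: BuzzardGeeLMS2014, Conj. 3.2.1 and Conj. 3.2.2] [cite: FontaineMazurGeometric1995, Conj. 1] -/
def ReciprocityUpToIrreducibilityR : Prop :=
  ∀ (F : Type) [Field F] [NumberField F], Nonempty (ReciprocityData F) ∧ ∀ (Rec : ReciprocityData F) (n : ℕ), 0 < n → ∀ hcpt : Literature.NumberTheory.Automorphic.isCompact_glFiniteIntegralLevel n F, (∀ π : Literature.NumberTheory.Automorphic.CuspidalAutomorphicRepData n F hcpt, π.1.IsLAlgebraic → ∀ (ℓ : ℕ) [Fact ℓ.Prime] (ι : PadicAlgCl ℓ ≃+* ℂ), ∃ ρ : Literature.NumberTheory.GaloisRepresentations.FramedGaloisRep F (PadicAlgCl ℓ) n, IsGeometricFramed Rec ρ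 ∧ Corresponds Rec ι π.1 ρ) ∧ GaloisToAutomorphic n Rec hcpt

/-- Child (2.2) (children.json `PairLBoundaryJS`; = item stmt-Langlands-13622 verbatim): Arthur–Clozel Ch. 3 (2.2)
for cuspidal Borel–Jacquet data. A theorem in print. [cite: ArthurClozelAMS120, Ch. 3 §2 (2.2)]
[cite: JacquetShalikaAJM1981II, Thm. 4.4] -/
def PairLBoundaryJS : Prop :=
  ∀ (n m : ℕ) (F : Type) [Field F] [NumberField F] (hF : _) (hF' : _), 0 < n → 0 < m → ∀ (π : Literature.NumberTheory.Automorphic.CuspidalAutomorphicRepData n F hF) (π' : Literature.NumberTheory.Automorphic.CuspidalAutomorphicRepData m F hF'), ∃ S₀ : Set (IsDedekindDomain.HeightOneSpectrum (NumberField.RingOfIntegers F)), S₀.Finite ∧ ∀ {S : Set (IsDedekindDomain.HeightOneSpectrum (NumberField.RingOfIntegers F))}, S.Finite → S₀ ⊆ S → ∀ {α β : IsDedekindDomain.HeightOneSpectrum (NumberField.RingOfIntegers F) → Multiset ℂ}, (∀ w ∉ S, π.1.HasSatakeParamAt w (α w)) → (∀ w ∉ S, π'.1.HasSatakeParamAt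 w (β w)) → (∀ w ∉ S, ‖(α w).prod‖ = 1) → (∀ w ∉ S, ‖(β w).prod‖ = 1) → ∀ {s₀ : ℂ}, s₀.re = 1 → ¬ (n = m ∧ ∀ᶠ w in cofinite, (α w).map ((((w.residueCard : ℂ) ^ (1 - s₀))) * ·) = (β w).map (·⁻¹)) → ∃ c : ℂ, c ≠ 0 ∧ Tendsto (fun s : ℂ => ∏' w : {w : IsDedekindDomain.HeightOneSpectrum (NumberField.RingOfIntegers F) // w ∉ S}, ((Literature.NumberTheory.Automorphic.satakePairPolynomial (α w.1) (β w.1)).eval ((w.1.residueCard : ℂ) ^ (-s)))⁻¹) (𝓝[{s : ℂ | 1 < s.re}] s₀) (𝓝 c)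

/-- Child (2.3) (children.json `PairLPoleJS`; = item stmt-Langlands-19093 verbatim): Arthur–Clozel Ch. 3 (2.3) =
Jacquet–Shalika II Prop. 3.6 for cuspidal Borel–Jacquet data. A theorem in print.
[cite: ArthurClozelAMS120, Ch. 3 §2 (2.3)] [cite: JacquetShalikaAJM1981II, Prop. 3.6] -/
def PairLPoleJS : Prop :=
  ∀ (n : ℕ) (F : Type) [Field F] [NumberField F] (hF : Literature.NumberTheory.Automorphic.isCompact_glFiniteIntegralLevel n F), 0 < n → ∀ (π π' : Literature.NumberTheory.Automorphic.CuspidalAutomorphicRepData n F hF), ∃ S₀ : Set (IsDedekindDomain.HeightOneSpectrum (NumberField.RingOfIntegers F)), S₀.Finite ∧ ∀ {S : Set (IsDedekindDomain.HeightOneSpectrum (NumberField.RingOfIntegers F))}, S.Finite → S₀ ⊆ S → ∀ {α β : IsDedekindDomain.HeightOneSpectrum (NumberField.RingOfIntegers F) → Multiset ℂ}, (∀ w ∉ S, π.1.HasSatakeParamAt w (α w)) → (∀ w ∉ S, π'.1.HasSatakeParamAt w (β w)) → (∀ w ∉ S, ‖(α w).prod‖ = 1) → (∀ w ∉ S, ‖(β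 w).prod‖ = 1) → ∀ {s₀ : ℂ}, s₀.re = 1 → (∀ᶠ w in cofinite, (α w).map ((((w.residueCard : ℂ) ^ (1 - s₀))) * ·) = (β w).map (·⁻¹)) → ∃ c : ℂ, c ≠ 0 ∧ Tendsto (fun s : ℂ => (s - s₀) * ∏' w : {w : IsDedekindDomain.HeightOneSpectrum (NumberField.RingOfIntegers F) // w ∉ S}, ((Literature.NumberTheory.Automorphic.satakePairPolynomial (α w.1) (β w.1)).eval ((w.1.residueCard : ℂ) ^ (-s)))⁻¹) (𝓝[{s : ℂ | 1 < s.re}] s₀) (𝓝 c)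

end Summit.Langlands.Langlands.Cruxes.IrreducibleOffPrimeRankSector.SplitReciprocityJS

open Summit.Langlands.Langlands.Theses.OrdinaryPrimeTransport (IrreducibleOffPrimeRankSector IrreduciblePrimeRank
  ReciprocityUpToIrreducibility)
open Summit.Langlands.Langlands.Cruxes.IrreducibleOffPrimeRankSector.SplitReciprocityJS

namespace Summit.Langlands.Langlands.Cruxes.IrreducibleOffPrimeRankSector.SplitReciprocityJS

/-! ## §1 The two analytic children ARE the Literature named facts (δ) -/

/-- The child `PairLBoundaryJS` (stmt-Langlands-13622) IS the named fact, definitionally. [folklore] -/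
theorem pairLBoundaryJS_iff : PairLBoundaryJS ↔ JacquetShalika1981_partialPairL_boundary_repData :=
  Iff.rfl

/-- The child `PairLPoleJS` (stmt-Langlands-19093) IS the named fact, definitionally. [folklore] -/
theorem pairLPoleJS_iff : PairLPoleJS ↔ JacquetShalika1981_partialPairL_pole_repData :=
  Iff.rfl

/-! ## §2 The glue (kernel-checked, no `sorry`) -/

/-- **Irreducibility of EVERY a.e.-compatible avatar of EVERY L-algebraic cuspidal `π`, every rank, every
number field, every `(ℓ, ι)`**, from E_R and Arthur–Clozel (2.2)–(2.3): fix `K`, take one reciprocity datum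
from the non-vacuity conjunct of E_R, and run the landed isobaric bootstrap
`isIrreducible_of_reciprocityUpToIrreducibility`. No sector hypothesis anywhere. [cite: CalegariGee2013, §1.1] -/
theorem irreducible_all_of_subs (hE : ReciprocityUpToIrreducibilityR) (h22 : PairLBoundaryJS)
    (h23 : PairLPoleJS) :
    ∀ (n : ℕ) (K : Type) [Field K] [NumberField K]
      (hcpt : Literature.NumberTheory.Automorphic.isCompact_glFiniteIntegralLevel n K), 0 < n →
      ∀ (π : Literature.NumberTheory.Automorphic.CuspidalAutomorphicRepData n K hcpt), π.1.IsLAlgebraic →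
      ∀ (ℓ : ℕ) [Fact ℓ.Prime] (ι : PadicAlgCl ℓ ≃+* ℂ)
        (ρ : Literature.NumberTheory.GaloisRepresentations.FramedGaloisRep K (PadicAlgCl ℓ) n),
        (∀ᶠ v : IsDedekindDomain.HeightOneSpectrum (NumberField.RingOfIntegers K) in Filter.cofinite,
          Summit.Langlands.SatakeFrobCompatibleAt ι π.1 ρ v) → ρ.toGaloisRep.IsIrreducible := by
  intro n K _ _ hcpt hn π hL ℓ _ ι ρ hρ
  obtain ⟨⟨Rec⟩, hRec⟩ := hE K
  exact isIrreducible_of_reciprocityUpToIrreducibility (pairLBoundaryJS_iff.mp h22)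
    (pairLPoleJS_iff.mp h23) (hRec Rec) hcpt hn π hL ι ρ hρ

/-- **THE GLUE of the split `IrreducibleOffPrimeRankSector ⟸ E_R ∧ (2.2) ∧ (2.3)`** — hypotheses = the three
children (local defs with the texts of children.json; δ-equal to the route decls the split adds), conclusion =
the route decl BY NAME; the crux's sector hypothesis is discarded. [cite: CalegariGee2013, §1.1]
[cite: BuzzardGeeLMS2014, Conj. 3.2.2] -/
theorem IrreducibleOffPrimeRankSector_of_subs (hE : ReciprocityUpToIrreducibilityR) (h22 : PairLBoundaryJS)
    (h23 : PairLPoleJS) : IrreducibleOffPrimeRankSector := by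
  intro n K _ _ hcpt hn π hL _ ℓ _ ι ρ hρ
  exact irreducible_all_of_subs hE h22 h23 n K hcpt hn π hL ℓ ι ρ hρ

/-- The same corollary on the route's CURRENT binder E = `ReciprocityUpToIrreducibility` (stmt-Langlands-14328,
the `∃ Rec` form, BY NAME): `PairLBoundaryJS → PairLPoleJS → E → IrreducibleOffPrimeRankSector`.
[cite: CalegariGee2013, §1.1] -/
theorem IrreducibleOffPrimeRankSector_of_reciprocity (h22 : PairLBoundaryJS) (h23 : PairLPoleJS)
    (hE : ReciprocityUpToIrreducibility) : IrreducibleOffPrimeRankSector := by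
  intro n K _ _ hcpt hn π hL _ ℓ _ ι ρ hρ
  obtain ⟨Rec, hRec⟩ := hE K
  exact isIrreducible_of_reciprocityUpToIrreducibility (pairLBoundaryJS_iff.mp h22)
    (pairLPoleJS_iff.mp h23) hRec hcpt hn π hL ι ρ hρ

/-- For the record (NOT progress on the sector): the route's TARGET `IrreduciblePrimeRank` is a corollary of the
same three hypotheses — E_R is summit-strength for the irreducibility clause; the route's own content is the
E-free proof of `IrreduciblePrimeRank` from its four cruxes. [cite: CalegariGee2013, §1.1] -/
theorem IrreduciblePrimeRank_of_subs (hE : ReciprocityUpToIrreducibilityR) (h22 : PairLBoundaryJS)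
    (h23 : PairLPoleJS) : IrreduciblePrimeRank := by
  intro K _ _ _ p _ h3 hcpt π hL _ _ ℓ _ ι ρ hρ
  exact irreducible_all_of_subs hE h22 h23 p K hcpt (by omega) π hL ℓ ι ρ hρ

/-- By-name sanity check (an `example`, not a declaration): the glue has exactly the split's shape
`E_R → (2.2) → (2.3) → crux`. -/
example : ReciprocityUpToIrreducibilityR → PairLBoundaryJS → PairLPoleJS → IrreducibleOffPrimeRankSector :=
  IrreducibleOffPrimeRankSector_of_subs

end Summit.Langlands.Langlands.Cruxes.IrreducibleOffPrimeRankSector.SplitReciprocityJS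

end
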